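import Mathlib
import Literature.AlgebraicGeometry.Resolution.ProjectiveModelsFunctionField
import Literature.AlgebraicGeometry.Resolution.ProjectiveModelsCharts
import Literature.AlgebraicGeometry.Motives.CartierDivisor
import HarnessLib

/-!
# Route `RadicialJung`, crux `CleanModels` (stmt-ResolutionOfSingularities-15917), line `Sketch` rev 15, stub 4c
# `stub_cleanGlobalization3`: a projective integral scheme containing `X'` as an open is a projective model of `K(X')`

For an open immersion `j : X' ↪ X̄` of integral schemes with `X̄` projective over `k`, `X̄` is a projective model of the
function field `K(X')` itself (`ProjModel.ofOpenImmersion`), with distinguished point `Spec K(X') → X' ↪ X̄`; the `k`-algebra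
structure of `K(X')` is the one READ OFF the structure morphism (`algebraOfStructureMorphism`, via `Spec.preimage`).  For this
model the identification `K(X̄) ≅ K(X')` of `ProjModel.funFieldIso` IS the pull-back `j^♯` (`functionFieldMap_eq_funFieldIso_hom`),
so that no transport of rational functions is needed downstream.  PROVED; bookkeeping for the projective closure of Chow's
modification in the clean globalization; nothing here proves resolution in characteristic `p`.
-/

noncomputable section

set_option linter.dupNamespace false -- mandated namespace of this single-conjunct summit

open CategoryTheory AlgebraicGeometry IsLocalRing
open Literature.AlgebraicGeometry.Resolution Literature.AlgebraicGeometry.Motives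

namespace Summit.ResolutionOfSingularities.ResolutionOfSingularities.Theorems.RadicialJung.CleanModels

section OfOpenImmersion

variable {k : Type} [Field k] {X' Xbar : Scheme.{0}} [IsIntegral X'] [IsIntegral Xbar]
  (j : X' ⟶ Xbar) (πXbar : Xbar ⟶ Spec (.of k))

/-- An open immersion of integral schemes is dominant. [folklore] -/
theorem isDominant_of_isOpenImmersion [IsOpenImmersion j] : IsDominant j :=
  ⟨j.isOpenEmbedding.isOpen_range.dense ⟨_, ⟨genericPoint X', rfl⟩⟩⟩

/-- **The `k`-algebra structure on `K(X')` read off the structure morphism**: the ring map `k → K(X')` whose `Spec` is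
`Spec K(X') → X' ↪ X̄ → Spec k`. [folklore] -/
@[reducible] def algebraOfStructureMorphism : Algebra k X'.functionField :=
  (Spec.preimage (X'.fromSpecStalk (genericPoint X') ≫ j ≫ πXbar)).hom.toAlgebra

omit [IsIntegral Xbar] in
/-- With that structure, `Spec (k → K(X')) = Spec K(X') → X' ↪ X̄ → Spec k`. [folklore] -/
theorem specMap_algebraMap_eq :
    letI := algebraOfStructureMorphism j πXbar
    Spec.map (CommRingCat.ofHom (algebraMap k X'.functionField)) =
      X'.fromSpecStalk (genericPoint X') ≫ j ≫ πXbar := by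
  letI := algebraOfStructureMorphism j πXbar
  change Spec.map (Spec.preimage (X'.fromSpecStalk (genericPoint X') ≫ j ≫ πXbar)) = _
  rw [Spec.map_preimage]

variable (hproj : Literature.AlgebraicGeometry.Motives.IsProjectiveOver (Over.mk πXbar)) [IsOpenImmersion j] [IsDominant j]

/-- **`X̄ ⊇ X'` as a projective model of `K(X')`** (distinguished point `Spec K(X') → X' ↪ X̄`, the generic point; the `k`-algebra
structure on `K(X')` must make `Spec K(X') → Spec k` the structure composite, e.g. `algebraOfStructureMorphism`).
[cite: ZariskiSamuel1960, Ch. VI §17] -/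
def ProjModel.ofOpenImmersion [Algebra k X'.functionField]
    (halg : Spec.map (CommRingCat.ofHom (algebraMap k X'.functionField)) =
      X'.fromSpecStalk (genericPoint X') ≫ j ≫ πXbar) : ProjModel k X'.functionField where
  X := Xbar
  π := πXbar
  gen := X'.fromSpecStalk (genericPoint X') ≫ j
  gen_π := by rw [Category.assoc, halg]
  isIntegral := ‹_›
  isProjectiveOver := hproj
  genericPt_eq := by
    rw [Scheme.Hom.comp_apply, Scheme.fromSpecStalk_closedPoint]
    exact RatFn.genericPoint_eq_of_isDominant j
  isIso_stalkClosedPointTo := by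
    rw [Scheme.stalkClosedPointTo_comp, Scheme.stalkClosedPointTo_fromSpecStalk]
    have h : ∀ x, IsIso (j.stalkMap x) := fun x => inferInstance
    exact IsIso.comp_isIso' (h _) inferInstance

variable [Algebra k X'.functionField]
  (halg : Spec.map (CommRingCat.ofHom (algebraMap k X'.functionField)) =
    X'.fromSpecStalk (genericPoint X') ≫ j ≫ πXbar)

/-- Unfolding. [folklore] -/
@[simp] theorem ProjModel.ofOpenImmersion_X : (ProjModel.ofOpenImmersion j πXbar hproj halg).X = Xbar := rfl

/-- Unfolding. [folklore] -/
@[simp] theorem ProjModel.ofOpenImmersion_π : (ProjModel.ofOpenImmersion j πXbar hproj halg).π = πXbar := rfl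

/-- Unfolding. [folklore] -/
theorem ProjModel.ofOpenImmersion_gen :
    (ProjModel.ofOpenImmersion j πXbar hproj halg).gen = X'.fromSpecStalk (genericPoint X') ≫ j := rfl

/-- **For this model, `K(X̄) ≅ K(X')` is `j^♯`.** Both satisfy `Spec (·) ≫ (Spec K(X̄) → X̄) = gen`
(`ProjModel.specMap_funFieldIso_hom_fromSpecStalk`, `specMap_functionFieldMap_fromSpecStalk`), and `Spec K(X̄) → X̄` is a
monomorphism. [folklore] -/
theorem ProjModel.funFieldIso_hom_ofOpenImmersion :
    (ProjModel.ofOpenImmersion j πXbar hproj halg).funFieldIso.hom = CommRingCat.ofHom (RatFn.functionFieldMap j) := by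
  have h1 := (ProjModel.ofOpenImmersion j πXbar hproj halg).specMap_funFieldIso_hom_fromSpecStalk
  have h2 := specMap_functionFieldMap_fromSpecStalk j
  change Spec.map _ ≫ Xbar.fromSpecStalk (genericPoint Xbar) = X'.fromSpecStalk (genericPoint X') ≫ j at h1
  have h3 : Spec.map (ProjModel.ofOpenImmersion j πXbar hproj halg).funFieldIso.hom ≫ Xbar.fromSpecStalk (genericPoint Xbar) =
      Spec.map (CommRingCat.ofHom (RatFn.functionFieldMap j)) ≫ Xbar.fromSpecStalk (genericPoint Xbar) :=
    h1.trans h2.symm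
  exact Spec.map_injective ((cancel_mono (Xbar.fromSpecStalk (genericPoint Xbar))).mp h3)

/-- Pointwise form. [folklore] -/
theorem ProjModel.funFieldIso_hom_ofOpenImmersion_apply (z : Xbar.functionField) :
    (ProjModel.ofOpenImmersion j πXbar hproj halg).funFieldIso.hom.hom z = RatFn.functionFieldMap j z := by
  rw [ProjModel.funFieldIso_hom_ofOpenImmersion]; rfl

/-- … and the inverse followed by `j^♯` is the identity of `K(X')`. [folklore] -/
theorem ProjModel.functionFieldMap_funFieldIso_inv_ofOpenImmersion (z : X'.functionField) :
    RatFn.functionFieldMap j ((ProjModel.ofOpenImmersion j πXbar hproj halg).funFieldIso.inv.hom z) = z := by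
  rw [← ProjModel.funFieldIso_hom_ofOpenImmersion_apply j πXbar hproj halg, ← CommRingCat.comp_apply, Iso.inv_hom_id]
  rfl

end OfOpenImmersion

end Summit.ResolutionOfSingularities.ResolutionOfSingularities.Theorems.RadicialJung.CleanModels

end
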